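import Summits.Langlands.Langlands.Theses.RationalPeriodQuarter
import Summits.Langlands.Langlands.Theorems.RationalPeriodQuarterHeckePreservesRationalPeriodsGlue
import Summits.Langlands.Langlands.Theorems.RationalPeriodQuarterHeckePreservesRationalPeriodsPieces

/-!
# `RationalPeriodQuarter.HeckePreservesRationalPeriods` (stmt-Langlands-2807) — proved (part 4/4)

The crux (rank 5 of route `RationalPeriodQuarter`, binder `h₄` of its certified `closes`; "Hecke stability of the
ℚ-structure": for `p ∤ N` and `σ ∈ Γ₀(N)` with `d_σ ≡ p (N)`, the normalised Hecke operator
`T'_p u = p^(-1/2) (Σ_{b<p} u((z+b)/p) + u(σ(pz)))` maps the quarter cusp forms `S(N)` to `S(N)` AND maps forms with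
a RATIONAL PERIOD CLASS to forms with a rational period class).  This part proves piece 3
`stub_heckePeriodIntertwining` (registered stub signature verbatim: the BLZ period cocycle intertwines `T'_p`
with the double-coset sum of slashed two-point periods — linearity `greenPeriod_finset_sum` of the period integral
and the pull-back law `greenPeriod_comp_smul` (BLZ (2.25) + (1.10a)) for the integer matrices `M_j` of determinant
`p`, where `p^(-1/2) (det M_j)^(1/2) = 1` cancels), and composes the three proved pieces through the assembly of
part 2/4 into `heckePreservesRationalPeriods_proof : Theses.RationalPeriodQuarter.HeckePreservesRationalPeriods`
(the route decl BY NAME; `heckePreservesRationalPeriods_iff` records that it unfolds to the restated form).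
(Provenance: part 4/4 of the verbatim re-cut of the registered, sorry-free crux line
`Summits/Langlands/Langlands/Cruxes/HeckePreservesRationalPeriods/Lines/decomposition.lean`
(planner-cstrat-stmt-Langlands-2807-r1, 2026-08-17, sha256 41344dedc33c…; re-verified rc 0 / 0 sorry / std axioms
2026-09-01) into `Theorems/` parts of at most 400 lines; namespace moved to `Theorems.HeckeRationalPeriods`, the
route-file import confined to part 4/4.  References: Bruggeman–Lewis–Zagier, Mem. AMS 1118 (2015) (2.25), (5.4)–(5.5a);
Diamond–Shurman GTM 228 Prop. 5.2.1; Mühlenbruch, J. Number Theory 118 (2006) 208–235.)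
-/

noncomputable section

set_option linter.dupNamespace false

open scoped MatrixGroups Topology ComplexConjugate
open Filter Set

namespace Summit.Langlands.Langlands.Theorems.HeckeRationalPeriods

open Literature.NumberTheory.Automorphic UpperHalfPlane

/-! ## Piece 3 PROVED: linearity and the pull-back law of the period integral, and the intertwining -/

section PeriodLaws

/-- A `C²` `λ_s`-eigenfunction on `ℍ` is an invariant eigenfunction for the trivial group. -/
theorem isInvariantEigenfunction_bot {s : ℂ} {u : ℍ → ℂ} (hC2 : IsC2 u)
    (heig : ∀ z : ℍ, hypLaplacian u z + s * (1 - s) * u z = 0) :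
    IsInvariantEigenfunction (⊥ : Subgroup (GL (Fin 2) ℝ)) s u :=
  ⟨hC2, heig, fun γ hγ z => by rw [Subgroup.mem_bot.mp hγ, one_smul]⟩

/-- **Pull-back law** (BLZ (2.25) + (1.10a) + (1.10c)): for `g ∈ GL₂⁺(ℝ)`, a `C²` `λ_s`-eigenfunction
`u` (`s ≠ 0, 1`) and `t` off the pole of `g`,
`∫_a^b [u∘g, R(t;·)^s] = (det g)^s · |ct+d|^{-2s} · ∫_{ga}^{gb} [u, R(gt;·)^s]`.
(BruggemanLewisZagier2015, (2.25) p. 16 and (1.10a) p. 11) -/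
theorem greenPeriod_comp_smul {s : ℂ} (hs0 : s ≠ 0) (hs1 : s ≠ 1) {u : ℍ → ℂ} {g : GL (Fin 2) ℝ}
    (hg : 0 < g.det.val) (hC2 : IsC2 u) (heig : ∀ z : ℍ, hypLaplacian u z + s * (1 - s) * u z = 0)
    (a b : ℍ) {t : ℝ} (ht : (g 1 0 : ℝ) * t + g 1 1 ≠ 0) :
    greenPeriod s (fun z => u (g • z)) a b t =
      ((g.det.val : ℝ) : ℂ) ^ s * lineSlash s g (greenPeriod s u (g • a) (g • b)) t := by
  have hue := isInvariantEigenfunction_bot hC2 heig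
  set M : ℂ → ℂ := fun w : ℂ => ((g • ofComplex w : ℍ) : ℂ) with hM
  set t' : ℝ := (g 0 0 * t + g 0 1) / (g 1 0 * t + g 1 1) with ht'
  set J : ℂ := ((|g 1 0 * t + g 1 1| : ℝ) : ℂ) ^ (-(2 * s)) with hJ
  set D : ℂ := ((g.det.val : ℝ) : ℂ) ^ s with hD
  -- `u ∘ g` on `ℂ`
  have hU : ((fun z => u (g • z)) ∘ ofComplex : ℂ → ℂ) = (u ∘ ofComplex) ∘ M := comp_smul_extend_eq g u
  -- `R(t; z)^s = (det g)^s |ct+d|^{-2s} R(gt; g z)^s` on `ℍ`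
  have hdet0 : ((g.det.val : ℝ) : ℂ) ≠ 0 := by exact_mod_cast hg.ne'
  have hV : EqOn (hypPoissonKernelCpow s t) (fun z => (D * J) * (hypPoissonKernelCpow s t' ∘ M) z)
      {z : ℂ | 0 < z.im} := by
    intro z hz
    have key := hypPoissonKernelCpow_glSmul s hg ⟨z, hz⟩ ht
    simp only [Function.comp_apply, hM, UpperHalfPlane.ofComplex_apply_of_im_pos hz]
    rw [← ht', ← hJ] at key
    -- key : J * R(t'; g z)^s = det^{-s} * R(t; z)^s
    have hDinv : D * ((g.det.val : ℝ) : ℂ) ^ (-s) = 1 := by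
      have hne : ((g.det.val : ℝ) : ℂ) ^ s ≠ 0 := Complex.cpow_ne_zero_iff.mpr (Or.inl hdet0)
      rw [hD, Complex.cpow_neg, mul_inv_cancel₀ hne]
    calc hypPoissonKernelCpow s t z
        = (D * ((g.det.val : ℝ) : ℂ) ^ (-s)) * hypPoissonKernelCpow s t z := by rw [hDinv, one_mul]
      _ = D * (((g.det.val : ℝ) : ℂ) ^ (-s) * hypPoissonKernelCpow s t (⟨z, hz⟩ : ℍ)) := by ring
      _ = D * (J * hypPoissonKernelCpow s t' ((g • (⟨z, hz⟩ : ℍ) : ℍ) : ℂ)) := by rw [← key]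
      _ = D * J * hypPoissonKernelCpow s t' ((g • (⟨z, hz⟩ : ℍ) : ℍ) : ℂ) := by ring
  -- change of variables along `g`
  have hchg := greenSegmentIntegral_comp_smul (g := g) hg hue.isC2 (contDiffOn_hypPoissonKernelCpow s t')
    (mul_laplacian_comm_of_eigen hue hs0 hs1 t') a b
  unfold greenPeriod
  rw [hU, greenSegmentIntegral_congr_upperHalfPlane (fun _ _ => rfl) hV a b,
    greenSegmentIntegral_const_mul, hchg, lineSlash_apply, ← hJ, ← ht']
  ring

/-- Pointwise linearity of the Green's form in the first function, given differentiability. -/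
theorem greenForm_finset_sum {ι : Type*} (S : Finset ι) (c : ι → ℂ) (U : ι → ℂ → ℂ) (V : ℂ → ℂ)
    {w : ℂ} (hU : ∀ i ∈ S, DifferentiableAt ℝ (U i) w) (h : ℂ) :
    greenForm (fun x => ∑ i ∈ S, c i * U i x) V w h = ∑ i ∈ S, c i * greenForm (U i) V w h := by
  unfold greenForm wirtingerDz
  have hd : fderiv ℝ (fun x => ∑ i ∈ S, c i * U i x) w = ∑ i ∈ S, c i • fderiv ℝ (U i) w := by
    rw [fderiv_fun_sum fun i hi => (hU i hi).const_mul (c i)]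
    exact Finset.sum_congr rfl fun i hi => fderiv_const_mul (hU i hi) (c i)
  rw [hd]
  simp only [FunLike.coe_sum, Finset.sum_apply, FunLike.coe_smul, Pi.smul_apply,
    smul_eq_mul, Finset.sum_mul, Finset.mul_sum, ← Finset.sum_sub_distrib, ← Finset.sum_add_distrib,
    Finset.sum_div]
  refine Finset.sum_congr rfl fun i _ => ?_
  ring

/-- Continuity of `τ ↦ [U, V]((1-τ)a + τb)(h)` on `[0,1]` for `C²` data on `ℍ` and `a, b ∈ ℍ`. -/
theorem continuousOn_greenForm_segment {U V : ℂ → ℂ} (hU : ContDiffOn ℝ 2 U {z : ℂ | 0 < z.im})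
    (hV : ContDiffOn ℝ 2 V {z : ℂ | 0 < z.im}) (a b : ℍ) (h : ℂ) :
    ContinuousOn (fun τ : ℝ => greenForm U V ((1 - (τ : ℂ)) * (a : ℂ) + (τ : ℂ) * (b : ℂ)) h) (uIcc 0 1) := by
  have hO : IsOpen {z : ℂ | 0 < z.im} := isOpen_upperHalfPlaneSet
  have hΩ := continuousOn_greenOneForm hO hU hV
  have hpath : Continuous fun τ : ℝ => (1 - (τ : ℂ)) * (a : ℂ) + (τ : ℂ) * (b : ℂ) := by fun_prop
  have hmaps : MapsTo (fun τ : ℝ => (1 - (τ : ℂ)) * (a : ℂ) + (τ : ℂ) * (b : ℂ)) (uIcc 0 1) {z : ℂ | 0 < z.im} := by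
    intro τ hτ
    rw [uIcc_of_le zero_le_one] at hτ
    show 0 < ((1 - (τ : ℂ)) * (a : ℂ) + (τ : ℂ) * (b : ℂ)).im
    have ha : 0 < (a : ℂ).im := a.coe_im_pos
    have hb : 0 < (b : ℂ).im := b.coe_im_pos
    simp only [Complex.add_im, Complex.mul_im, Complex.sub_re, Complex.one_re, Complex.ofReal_re,
      Complex.sub_im, Complex.one_im, Complex.ofReal_im, sub_zero, zero_mul, add_zero]
    rcases eq_or_lt_of_le hτ.1 with h0 | h0
    · rw [← h0]; simpa using ha
    · have : 0 ≤ 1 - τ := by linarith [hτ.2]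
      nlinarith [mul_nonneg this ha.le, mul_pos h0 hb]
  have hcomp := (hΩ.comp hpath.continuousOn hmaps).clm_apply continuousOn_const (g := fun _ => h)
  refine hcomp.congr fun τ _ => ?_
  simp only [Function.comp_apply, greenForm, add_apply, smul_apply,
    ContinuousLinearMap.id_apply, ContinuousLinearEquiv.coe_coe, Complex.conjCLE_apply, smul_eq_mul]

/-- **Linearity of the period integral** in `u` over `C²` functions on `ℍ` (the Green's form is
linear and each summand is integrable along the compact segment). (BruggemanLewisZagier2015, (1.9) p. 11) -/
theorem greenPeriod_finset_sum (s : ℂ) {n : ℕ} (c : Fin n → ℂ) (v : Fin n → ℍ → ℂ)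
    (hv : ∀ i, IsC2 (v i)) (a b : ℍ) (t : ℝ) :
    greenPeriod s (fun z => ∑ i, c i * v i z) a b t = ∑ i, c i * greenPeriod s (v i) a b t := by
  unfold greenPeriod greenSegmentIntegral
  have hO : IsOpen {z : ℂ | 0 < z.im} := isOpen_upperHalfPlaneSet
  set dw : ℂ := (b : ℂ) - (a : ℂ)
  -- pointwise linearity along the segment
  have hpt : ∀ τ ∈ uIcc (0 : ℝ) 1,
      greenForm ((fun z => ∑ i, c i * v i z) ∘ ofComplex) (hypPoissonKernelCpow s t)
          ((1 - (τ : ℂ)) * (a : ℂ) + (τ : ℂ) * (b : ℂ)) dw =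
        ∑ i, c i * greenForm (v i ∘ ofComplex) (hypPoissonKernelCpow s t)
          ((1 - (τ : ℂ)) * (a : ℂ) + (τ : ℂ) * (b : ℂ)) dw := by
    intro τ hτ
    rw [uIcc_of_le zero_le_one] at hτ
    have hz : 0 < ((1 - (τ : ℂ)) * (a : ℂ) + (τ : ℂ) * (b : ℂ)).im := by
      have ha : 0 < (a : ℂ).im := a.coe_im_pos
      have hb : 0 < (b : ℂ).im := b.coe_im_pos
      simp only [Complex.add_im, Complex.mul_im, Complex.sub_re, Complex.one_re, Complex.ofReal_re,
        Complex.sub_im, Complex.one_im, Complex.ofReal_im, sub_zero, zero_mul, add_zero]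
      rcases eq_or_lt_of_le hτ.1 with h0 | h0
      · rw [← h0]; simpa using ha
      · have : 0 ≤ 1 - τ := by linarith [hτ.2]
        nlinarith [mul_nonneg this ha.le, mul_pos h0 hb]
    have e : ((fun z => ∑ i, c i * v i z) ∘ ofComplex : ℂ → ℂ) = fun x => ∑ i ∈ Finset.univ, c i * (v i ∘ ofComplex) x := by
      funext x; simp
    rw [e]
    exact greenForm_finset_sum Finset.univ c (fun i => v i ∘ ofComplex) _
      (fun i _ => ((hv i).contDiffAt (hO.mem_nhds hz)).differentiableAt (by norm_num)) dw
  rw [intervalIntegral.integral_congr hpt]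
  rw [intervalIntegral.integral_finsetSum fun i _ => ?_]
  · exact Finset.sum_congr rfl fun i _ => intervalIntegral.integral_const_mul _ _
  · have hcont := continuousOn_greenForm_segment (hv i) (contDiffOn_hypPoissonKernelCpow s t) a b dw
    exact hcont.intervalIntegrable.const_mul (c i)

variable {p : ℕ}

/-- **stub_heckePeriodIntertwining** (registered stub; child `HeckePeriodIntertwining`, crux), PROVED:
the period cocycle of `T'_p u` is the double-coset sum of the slashed two-point periods of `u`, off the
poles of the `M_j` — linearity, the `p + 1` pull-backs, and `p^{-1/2} (det M_j)^{1/2} = 1`.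
(BruggemanLewisZagier2015, (2.25) p. 16 and (5.5a) p. 29) -/
theorem stub_heckePeriodIntertwining : let IsQuarterCuspForm : ℕ → (UpperHalfPlane → ℂ) → Prop := fun N u => Literature.NumberTheory.Automorphic.IsC2 u ∧ (∀ γ ∈ CongruenceSubgroup.Gamma1 N, ∀ z : UpperHalfPlane, u (γ • z) = u z) ∧ (∀ z : UpperHalfPlane, Literature.NumberTheory.Automorphic.hypLaplacian u z + (1 / 4 : ℂ) * u z = 0) ∧ ∃ C : ℝ, ∀ z : UpperHalfPlane, ‖u z‖ ≤ C; ∀ N : ℕ, 0 < N → ∀ p : ℕ, p.Prime → ¬ p ∣ N → ∀ σ ∈ CongruenceSubgroup.Gamma0 N, (((σ : Matrix (Fin 2) (Fin 2) ℤ) 1 1 : ℤ) : ZMod N) = (p : ZMod N) → let M : Fin (p + 1) → Matrix (Fin 2) (Fin 2) ℤ := (fun j : Fin (p + 1) => if (j : ℕ) < p then !![(1 : ℤ), ((j : ℕ) : ℤ); 0, (p : ℤ)] else (σ : Matrix (Fin 2) (Fin 2) ℤ) * !![(p : ℤ), 0; 0, 1]); let A : Fin (p + 1) → UpperHalfPlane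 → UpperHalfPlane := (fun (j : Fin (p + 1)) (z : UpperHalfPlane) => if (j : ℕ) < p then UpperHalfPlane.ofComplex (((z : ℂ) + ((j : ℕ) : ℂ)) / (p : ℂ)) else σ • UpperHalfPlane.ofComplex ((p : ℂ) * (z : ℂ))); ∀ u : UpperHalfPlane → ℂ, IsQuarterCuspForm N u → ∀ γ : Matrix.SpecialLinearGroup (Fin 2) ℤ, ∀ᶠ t in Filter.cofinite, Literature.NumberTheory.Automorphic.lewisZagierCocycle (1 / 2) UpperHalfPlane.I (fun z : UpperHalfPlane => ((Real.sqrt p : ℝ) : ℂ)⁻¹ * (∑ b ∈ Finset.range p, u (UpperHalfPlane.ofComplex (((z : ℂ) + b) / p)) + u (σ • UpperHalfPlane.ofComplex ((p : ℂ) * (z : ℂ))))) (Matrix.SpecialLinearGroup.mapGL ℝ γ) t = ∑ j : Fin (p + 1), Literature.NumberTheory.Automorphic.slashHalf (M j) (Literature.NumberTheory.Automorphic.greenPeriod (1 / 2) u (A j (γ⁻¹ • UpperHalfPlane.I)) (A j UpperHalfPlane.I)) t := by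
  intro IsQCF N hN p hp hpN σ hσ hσp M A u hu γ
  show ∀ᶠ t in cofinite,
    lewisZagierCocycle (1 / 2) UpperHalfPlane.I (heckeT p σ u) (Matrix.SpecialLinearGroup.mapGL ℝ γ) t =
      ∑ j : Fin (p + 1), Literature.NumberTheory.Automorphic.slashHalf (heckeMat p σ j)
        (greenPeriod (1 / 2) u (heckeAct p σ j (γ⁻¹ • UpperHalfPlane.I)) (heckeAct p σ j UpperHalfPlane.I)) t
  obtain ⟨hC2, -, heig4, -⟩ := (hu : IsQuarterCuspFormR N u)
  have hp0 : (0 : ℝ) < p := by exact_mod_cast hp.pos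
  have heig : ∀ z : ℍ, hypLaplacian u z + (1 / 2 : ℂ) * (1 - 1 / 2) * u z = 0 := fun z => by
    have h := heig4 z
    rw [← h]; norm_num
  have hcancel : ∀ j : Fin (p + 1),
      ((Real.sqrt p : ℝ) : ℂ)⁻¹ * (((heckeGL σ hp j).det.val : ℝ) : ℂ) ^ (1 / 2 : ℂ) = 1 := by
    intro j
    have hdet : ((heckeGL σ hp j).det.val : ℝ) = (p : ℝ) := by
      unfold heckeGL; rw [glOfDet_det, heckeMat_det σ hp j]; push_cast; rfl
    rw [hdet, show (1 / 2 : ℂ) = ((1 / 2 : ℝ) : ℂ) by norm_num, ← Complex.ofReal_cpow hp0.le,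
      ← Real.sqrt_eq_rpow]
    have hs : ((Real.sqrt p : ℝ) : ℂ) ≠ 0 := by exact_mod_cast (Real.sqrt_pos.mpr hp0).ne'
    exact inv_mul_cancel₀ hs
  have hpoles : ∀ᶠ t in cofinite, ∀ j : Fin (p + 1),
      (heckeGL σ hp j) 1 0 * t + (heckeGL σ hp j) 1 1 ≠ 0 :=
    Filter.eventually_all.mpr fun j => eventually_cofinite_ne_linePole (heckeGL σ hp j)
  filter_upwards [hpoles] with t ht
  rw [lewisZagierCocycle, heckeT_eq_sum hp σ u,
    greenPeriod_finset_sum (1 / 2) (fun _ => ((Real.sqrt p : ℝ) : ℂ)⁻¹) (fun j z => u (heckeGL σ hp j • z))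
      (fun j => isC2_comp_smul hC2 (heckeGL_det_pos σ hp j))]
  refine Finset.sum_congr rfl fun j _ => ?_
  rw [greenPeriod_comp_smul one_half_ne_zero' one_half_ne_one' (heckeGL_det_pos σ hp j) hC2 heig _ _ (ht j),
    ← mul_assoc, hcancel j, one_mul, slashHalf_heckeMat hp σ j, heckeAct_eq_smul σ hp j, heckeAct_eq_smul σ hp j,
    sl_smul_eq_mapGL_smul, map_inv]

end PeriodLaws

/-! ## The route decl and the composition -/

/-- The route decl unfolds to the restatement over the named helpers of part 1/4 (definitional). -/
theorem heckePreservesRationalPeriods_iff :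
    Summit.Langlands.Langlands.Theses.RationalPeriodQuarter.HeckePreservesRationalPeriods ↔
      HeckePreservesRationalPeriodsR := Iff.rfl

/-- **COMPOSITION**: the restated crux from the three proved pieces, through the sorry-free assembly
`heckePreservesRationalPeriods_of_subs` of part 2/4. -/
theorem heckePreservesRationalPeriodsR_holds : HeckePreservesRationalPeriodsR :=
  (heckePreservesRationalPeriods_of_subs :
      HeckeStableQuarterForms → HeckeCosetPermutation → HeckePeriodIntertwining → HeckePreservesRationalPeriodsR)
    stub_heckeStableQuarterForms stub_heckeCosetPermutation stub_heckePeriodIntertwining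

end Summit.Langlands.Langlands.Theorems.HeckeRationalPeriods

namespace Summit.Langlands.Langlands.Theorems

/-- `RationalPeriodQuarter.HeckePreservesRationalPeriods` (stmt-Langlands-2807; binder `h₄` of the route's certified
`closes`): the normalised Hecke operator `T'_p` (`p ∤ N`) preserves the quarter cusp forms on `Γ₁(N)` and the forms
with a rational period class.  Proved from the three pieces of the registered line `decomposition`. -/
theorem heckePreservesRationalPeriods_proof :
    Summit.Langlands.Langlands.Theses.RationalPeriodQuarter.HeckePreservesRationalPeriods :=
  HeckeRationalPeriods.heckePreservesRationalPeriods_iff.mpr HeckeRationalPeriods.heckePreservesRationalPeriodsR_holds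

end Summit.Langlands.Langlands.Theorems
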